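import Mathlib
import Summits.Ventures.PercRepro2.CoinChainXAGeneralGateAlg
import Summits.Ventures.PercRepro2.CoinChainXAStarCert
import Summits.Ventures.PercRepro2.CoinChainXASixGateJGenCert
import Summits.Ventures.PercRepro2.CoinChainXAGateHull

/-!
# The general gate of the six-cell (XA′) at the cell level
(blind cell PercRepro2, night-2 g28; proofs/NIGHT2-DARC.md §69)

`xa_general_gate_cells`: in the 18 cell masses (`νc`, `νd`, `νd'` on the six cells), the cleared (XA′)
`Cross ≤ a0·U001` of an ARBITRARY gate follows from the cellwise order facts, the five gate facts, the
facts of the closed / top / `1[j ∈ W]` gate certificates and the facts of the (★) certificate — by the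
bilinear corner argument `xa_general_gate_alg`.  The bridge to the chain data is CoinChainXAGeneralGate.lean.
-/

namespace Summit.Ventures.PercRepro2.Coin

section GeneralGateCells

variable {R : Type*} [Field R] [LinearOrder R] [IsStrictOrderedRing R]

set_option maxHeartbeats 1600000 in
/-- **THE GENERAL GATE OF THE SIX-CELL (XA′), CELL LEVEL.** -/
theorem xa_general_gate_cells (o a₀ a₁ b r₀ r₁ ou a₀u a₁u bu r₀u r₁u ow a₀w a₁w bw r₀w r₁w : R)
    (ho : 0 ≤ o) (ha₀ : 0 ≤ a₀) (ha₁ : 0 ≤ a₁) (hb : 0 ≤ b) (hr₀ : 0 ≤ r₀) (hr₁ : 0 ≤ r₁) (hou : 0 ≤ ou) (ha₀u : 0 ≤ a₀u) (ha₁u : 0 ≤ a₁u) (hbu : 0 ≤ bu) (hr₀u : 0 ≤ r₀u) (hr₁u : 0 ≤ r₁u) (_how : 0 ≤ ow) (ha₀w : 0 ≤ a₀w) (ha₁w : 0 ≤ a₁w) (hbw : 0 ≤ bw) (hr₀w : 0 ≤ r₀w) (hr₁w : 0 ≤ r₁w)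
    (hord_I0 : ou ≤ o) (hord_Dp0 : a₀u ≤ a₀) (hord_Dp1 : a₁u ≤ a₁) (hord_Dpp : bu ≤ b) (hord_Dst0 : r₀u ≤ r₀) (hord_Dst1 : r₁u ≤ r₁)
    (_hw_I0 : ow ≤ ou) (_hw_Dp0 : a₀w ≤ a₀u) (hw_Dp1 : a₁w ≤ a₁u) (hw_Dpp : bw ≤ bu) (hw_Dst0 : r₀w ≤ r₀u) (hw_Dst1 : r₁w ≤ r₁u)
    (H2 : r₁u * a₁w ≤ a₁u * r₁w) (H3 : r₁u * (bw + (r₀w)) ≤ (bu + (r₀u)) * r₁w) (H4 : a₀u * ow ≤ ou * a₀w)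
    (H5 : a₁w * (bw + (r₀w)) ≤ (ow + (a₀w)) * r₁w)
    (h1 : a₁ * (bu + r₀u) ≤ (o + a₀) * r₁u) (h3 : a₁ * a₀u ≤ (o + a₀) * a₁u) (h2' : a₀u * (b + (r₀)) ≤ (o + (a₀)) * r₀u)
    (j0 : a₀ * a₀ ≤ (a₀ + (o)) * a₀)
    (j1 : a₁ * bu ≤ o * r₁u)
    (j2 : a₁ * r₀u ≤ (a₀ + (o)) * r₁u)
    (j3 : r₀u * r₁u ≤ (bu + (r₀u)) * r₁u)
    (j4 : a₀ * a₁ ≤ (a₀ + (o)) * a₁)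
    (j5 : a₀ * r₁u ≤ (a₀ + (o)) * r₁u)
    (j6 : a₀ * r₀u ≤ (a₀ + (o)) * r₀u)
    (j7 : a₁ * (bu + (r₀u)) ≤ (a₀ + (o)) * r₁u)
    (j8 : a₁u * (bu + (r₀u)) ≤ (a₀u + (ou)) * r₁u)
    (j9 : (r₁ + (o)) * (a₀ + (a₁ + (o))) ≤ (a₀ + (a₁ + (o))) * (a₀ + (a₁ + (r₁ + (o)))))
    (j10 : (r₁u + (ou)) * (bu + (r₀u + (r₁u))) ≤ (bu + (r₀u + (r₁u + (ou)))) * (bu + (r₀u + (r₁u))))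
    (j11 : (a₁ + (b)) * (bu + (r₀u + (r₁u))) ≤ (a₀ + (a₁ + (b + (o)))) * (bu + (r₀u + (r₁u))))
    (j12 : (a₁u + (r₀u)) * (a₀ + (a₁ + (o))) ≤ (a₀ + (a₁ + (o))) * (a₁u + (r₀u + (r₁u))))
    (s0 : ou * a₀ ≤ o * a₀u)
    (s1 : r₀u * r₁u ≤ (bu + (r₀u)) * r₁u)
    (s2 : a₀ * r₁u ≤ (o + (a₀)) * r₁u)
    (s3 : a₁u * (bu + (r₀u)) ≤ (ou + (a₀u)) * r₁u)
    (s4 : a₀u * r₁u ≤ (ou + (a₀u)) * r₁u)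
    (s5 : a₁u * (b + (r₀)) ≤ (o + (a₀)) * r₁u)
    (s6 : a₁ * (bu + (r₀u)) ≤ (o + (a₀)) * r₁u)
    (s7 : (o + (a₁)) * (a₁u + (bu)) ≤ (o + (a₁)) * (a₁u + (bu + (r₁u))))
    (s8 : (a₀u + (bu)) * (bu + (r₀u)) ≤ (ou + (a₀u + (bu))) * (bu + (r₀u)))
    (s9 : a₀u * a₁u ≤ (ou + (a₀u)) * a₁u)
    (s10 : a₁ * bu ≤ o * r₁u)
    (s11 : a₁ * r₀u ≤ (o + (a₀)) * r₁u)
    (s12 : (ou + (a₁u)) * (a₁u + (bu)) ≤ (ou + (a₁u)) * (a₁u + (bu + (r₁u))))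
    (s13 : (a₁ + (b)) * (bu + (r₁u)) ≤ (o + (a₁ + (b))) * (bu + (r₁u))) :
    ((o + a₀ + a₁ + bu + r₀u + r₁u) * (bu + r₀u + r₁u) - (bu + r₀u + r₁u) * (o + a₀u + a₁u + bu + r₀u + r₁u)) * ((o + a₀ + a₁ + bu + r₀u + r₁u) * (a₁ + r₁w) - (a₁ + r₁u) * (o + a₀ + a₁ + bw + r₀w + r₁w)) + ((o + a₀ + a₁ + bu + r₀u + r₁u) * (a₁u + r₁u) - (a₁ + r₁u) * (o + a₀u + a₁u + bu + r₀u + r₁u)) * ((o + a₀ + a₁ + bu + r₀u + r₁u) * (bw + r₀w + r₁w) - (bu + r₀u + r₁u) * (o + a₀ + a₁ + bw + r₀w + r₁w))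
    ≤ (o + a₀ + a₁ + bu + r₀u + r₁u) * ((o + a₀ + a₁ + bu + r₀u + r₁u) * (o + a₀ + a₁ + bu + r₀u + r₁u) * r₁w - (o + a₀ + a₁ + bu + r₀u + r₁u) * (a₁ + r₁u) * (bw + r₀w + r₁w) - (o + a₀ + a₁ + bu + r₀u + r₁u) * (bu + r₀u + r₁u) * (a₁w + r₁w) + (bu + r₀u + r₁u) * (a₁ + r₁u) * (o + a₀w + a₁w + bw + r₀w + r₁w)) := by
  have h2 : a₀u * (bu + r₀u) ≤ (o + a₀) * r₀u := by
    have := mul_le_mul_of_nonneg_left (add_le_add hord_Dpp hord_Dst0) ha₀u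
    linarith
  -- the closed-gate value
  have hF0' := xa_six_zero_cert o a₀ a₁ a₀u a₁u bu r₀u r₁u ho ha₀ ha₁ hbu hr₀u hr₁u hord_Dp0 hord_Dp1 h1 h3
  have hFT' := xa_six_topgate_cert o a₀ a₁ a₀u a₁u bu r₀u r₁u ho ha₀ ha₁ ha₀u ha₁u hbu hr₀u hr₁u h1 h3 h2
  have hFJ' := xa_six_gateJGen_cert o a₀ a₁ b r₀ r₁ ou a₀u a₁u bu r₀u r₁u ho ha₀ ha₁ hb hr₀ hr₁ hou ha₀u ha₁u hbu hr₀u hr₁u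
    hord_Dp0 hord_Dp1 hord_Dpp hord_Dst0 hord_Dst1 hord_I0 j0 j1 j2 j3 j4 j5 j6 j7 j8 j9 j10 j11 j12
  have hS' := xa_star_cert o a₀ a₁ b r₀ r₁ ou a₀u a₁u bu r₀u r₁u ho ha₀ ha₁ hb hr₀ hr₁ hou ha₀u ha₁u hbu hr₀u hr₁u
    hord_I0 hord_Dp0 hord_Dp1 hord_Dpp hord_Dst0 hord_Dst1 s0 s1 s2 s3 s4 s5 s6 s7 s8 s9 s10 s11 s12 s13
  have hF0 : 0 ≤ ((bu + r₀u + r₁u) * (((o + a₀ + a₁) * (o + a₀ + a₁ + bu + r₀u + r₁u) * (a₁u + r₁u) + ((o + a₀ + a₁) - (bu + r₀u + r₁u)) * (a₁ + r₁u) * (a₀ + a₁ - a₀u - a₁u)) - (o + a₀ + a₁ + bu + r₀u + r₁u) * (a₁ + r₁u) * (a₀u + a₁u) - (o + a₀ + a₁ + bu + r₀u + r₁u) * a₁ * (a₀ + a₁ - a₀u - a₁u))) := by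
    have e : ((bu + r₀u + r₁u) * (((o + a₀ + a₁) * (o + a₀ + a₁ + bu + r₀u + r₁u) * (a₁u + r₁u) + ((o + a₀ + a₁) - (bu + r₀u + r₁u)) * (a₁ + r₁u) * (a₀ + a₁ - a₀u - a₁u)) - (o + a₀ + a₁ + bu + r₀u + r₁u) * (a₁ + r₁u) * (a₀u + a₁u) - (o + a₀ + a₁ + bu + r₀u + r₁u) * a₁ * (a₀ + a₁ - a₀u - a₁u))) = ((o + a₀ + a₁ + bu + r₀u + r₁u) *         ((o + a₀ + a₁ + bu + r₀u + r₁u) * (o + a₀ + a₁ + bu + r₀u + r₁u) * 0           - (o + a₀ + a₁ + bu + r₀u + r₁u) * (a₁ + r₁u) * 0           - (o + a₀ + a₁ + bu + r₀u + r₁u) * (bu + r₀u + r₁u) * 0           + (bu + r₀u + r₁u) * (a₁ + r₁u) * o)) - (((o + a₀ + a₁ + bu + r₀u + r₁u) * (bu + r₀u + r₁u)         - (bu + r₀u + r₁u) * (o + a₀u + a₁u + bu + r₀u + r₁u)) *       ((o + a₀ + a₁ + bu + r₀u + r₁u) * a₁ - (a₁ + r₁u) * (o + a₀ + a₁))     +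 ((o + a₀ + a₁ + bu + r₀u + r₁u) * (a₁u + r₁u)         - (a₁ + r₁u) * (o + a₀u + a₁u + bu + r₀u + r₁u)) *       ((o + a₀ + a₁ + bu + r₀u + r₁u) * 0 - (bu + r₀u + r₁u) * (o + a₀ + a₁))) := by ring
    rw [e]; exact sub_nonneg.2 hF0'
  have hFT : 0 ≤ ((bu + r₀u + r₁u) * (((o + a₀ + a₁) * (o + a₀ + a₁ + bu + r₀u + r₁u) * (a₁u + r₁u) + ((o + a₀ + a₁) - (bu + r₀u + r₁u)) * (a₁ + r₁u) * (a₀ + a₁ - a₀u - a₁u)) - (o + a₀ + a₁ + bu + r₀u + r₁u) * (a₁ + r₁u) * (a₀u + a₁u) - (o + a₀ + a₁ + bu + r₀u + r₁u) * a₁ * (a₀ + a₁ - a₀u - a₁u))) + ((o + a₀ + a₁ + bu + r₀u + r₁u) * (o + a₀ + a₁ + bu + r₀u + r₁u) * (o + a₀ + a₁) - ((o + a₀ + a₁) * (o + a₀ + a₁ + bu + r₀u + r₁u) * (a₁u + r₁u) + ((o + a₀ + a₁) - (bu + r₀u + r₁u)) * (a₁ + r₁u) * (a₀ + a₁ - a₀u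 - a₁u)) - (bu + r₀u + r₁u) * (o + a₀ + a₁ + bu + r₀u + r₁u) * (a₀ + a₁ - a₀u - a₁u)) * r₁u := by
    have e : ((bu + r₀u + r₁u) * (((o + a₀ + a₁) * (o + a₀ + a₁ + bu + r₀u + r₁u) * (a₁u + r₁u) + ((o + a₀ + a₁) - (bu + r₀u + r₁u)) * (a₁ + r₁u) * (a₀ + a₁ - a₀u - a₁u)) - (o + a₀ + a₁ + bu + r₀u + r₁u) * (a₁ + r₁u) * (a₀u + a₁u) - (o + a₀ + a₁ + bu + r₀u + r₁u) * a₁ * (a₀ + a₁ - a₀u - a₁u))) + ((o + a₀ + a₁ + bu + r₀u + r₁u) * (o + a₀ + a₁ + bu + r₀u + r₁u) * (o + a₀ + a₁) - ((o + a₀ + a₁) * (o + a₀ + a₁ + bu + r₀u + r₁u) * (a₁u + r₁u) + ((o + a₀ + a₁) - (bu + r₀u + r₁u)) * (a₁ + r₁u) * (a₀ + a₁ - a₀u - a₁u)) - (bu + r₀u + r₁u) * (o + a₀ + a₁ + bu + r₀u + r₁u) * (a₀ + a₁ - a₀u - a₁u)) * r₁u = ((o + a₀ + a₁ + bu + r₀u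 + r₁u) *         ((o + a₀ + a₁ + bu + r₀u + r₁u) * (o + a₀ + a₁ + bu + r₀u + r₁u) * r₁u           - (o + a₀ + a₁ + bu + r₀u + r₁u) * (a₁ + r₁u) * r₁u           - (o + a₀ + a₁ + bu + r₀u + r₁u) * (bu + r₀u + r₁u) * r₁u           + (bu + r₀u + r₁u) * (a₁ + r₁u) * (o + r₁u))) - (((o + a₀ + a₁ + bu + r₀u + r₁u) * (bu + r₀u + r₁u)         - (bu + r₀u + r₁u) * (o + a₀u + a₁u + bu + r₀u + r₁u)) *       ((o + a₀ + a₁ + bu + r₀u + r₁u) * (a₁ + r₁u) - (a₁ + r₁u) * (o + a₀ + a₁ + r₁u))     + ((o + a₀ + a₁ + bu + r₀u + r₁u) * (a₁u + r₁u)         - (a₁ + r₁u) * (o + a₀u + a₁u + bu + r₀u + r₁u)) *       ((o + a₀ + a₁ + bu + r₀u + r₁u) * r₁u - (bu + r₀u + r₁u) * (o + a₀ + a₁ + r₁u))) := by ring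
    rw [e]; exact sub_nonneg.2 hFT'
  have hFJ : 0 ≤ ((bu + r₀u + r₁u) * (((o + a₀ + a₁) * (o + a₀ + a₁ + bu + r₀u + r₁u) * (a₁u + r₁u) + ((o + a₀ + a₁) - (bu + r₀u + r₁u)) * (a₁ + r₁u) * (a₀ + a₁ - a₀u - a₁u)) - (o + a₀ + a₁ + bu + r₀u + r₁u) * (a₁ + r₁u) * (a₀u + a₁u) - (o + a₀ + a₁ + bu + r₀u + r₁u) * a₁ * (a₀ + a₁ - a₀u - a₁u))) + ((o + a₀ + a₁ + bu + r₀u + r₁u) * (o + a₀ + a₁ + bu + r₀u + r₁u) * (o + a₀ + a₁) - ((o + a₀ + a₁) * (o + a₀ + a₁ + bu + r₀u + r₁u) * (a₁u + r₁u) + ((o + a₀ + a₁) - (bu + r₀u + r₁u)) * (a₁ + r₁u) * (a₀ + a₁ - a₀u - a₁u)) - (bu + r₀u + r₁u) * (o + a₀ + a₁ + bu + r₀u + r₁u) * (a₀ + a₁ - a₀u - a₁u)) * r₁u - (bu + r₀u + r₁u) * (o + a₀ + a₁ + bu + r₀u + r₁u) * ((o + a₀ + a₁ + bu + r₀u + r₁u)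 - (a₁ + r₁u)) * a₁u := by
    have e : ((bu + r₀u + r₁u) * (((o + a₀ + a₁) * (o + a₀ + a₁ + bu + r₀u + r₁u) * (a₁u + r₁u) + ((o + a₀ + a₁) - (bu + r₀u + r₁u)) * (a₁ + r₁u) * (a₀ + a₁ - a₀u - a₁u)) - (o + a₀ + a₁ + bu + r₀u + r₁u) * (a₁ + r₁u) * (a₀u + a₁u) - (o + a₀ + a₁ + bu + r₀u + r₁u) * a₁ * (a₀ + a₁ - a₀u - a₁u))) + ((o + a₀ + a₁ + bu + r₀u + r₁u) * (o + a₀ + a₁ + bu + r₀u + r₁u) * (o + a₀ + a₁) - ((o + a₀ + a₁) * (o + a₀ + a₁ + bu + r₀u + r₁u) * (a₁u + r₁u) + ((o + a₀ + a₁) - (bu + r₀u + r₁u)) * (a₁ + r₁u) * (a₀ + a₁ - a₀u - a₁u)) - (bu + r₀u + r₁u) * (o + a₀ + a₁ + bu + r₀u + r₁u) * (a₀ + a₁ - a₀u - a₁u)) * r₁u - (bu + r₀u + r₁u) * (o + a₀ + a₁ + bu + r₀u + r₁u) * ((o + a₀ + a₁ + bu + r₀u + r₁u) - (a₁ + r₁u))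 * a₁u = ((o + a₀ + a₁ + bu + r₀u + r₁u) * ((o + a₀ + a₁ + bu + r₀u + r₁u) * (o + a₀ + a₁ + bu + r₀u + r₁u) * (r₁u) - (o + a₀ + a₁ + bu + r₀u + r₁u) * (a₁ + r₁u) * (0 + 0 + r₁u) - (o + a₀ + a₁ + bu + r₀u + r₁u) * (bu + r₀u + r₁u) * (a₁u + r₁u) + (bu + r₀u + r₁u) * (a₁ + r₁u) * (o + 0 + a₁u + 0 + 0 + r₁u))) - (((o + a₀ + a₁ + bu + r₀u + r₁u) * (bu + r₀u + r₁u) - (bu + r₀u + r₁u) * (o + a₀u + a₁u + bu + r₀u + r₁u)) * ((o + a₀ + a₁ + bu + r₀u + r₁u) * (a₁ + r₁u) - (a₁ + r₁u) * (o + a₀ + a₁ + 0 + 0 + r₁u))     + ((o + a₀ + a₁ + bu + r₀u + r₁u) * (a₁u + r₁u) - (a₁ + r₁u) * (o + a₀u + a₁u + bu + r₀u + r₁u)) * ((o + a₀ + a₁ + bu + r₀u + r₁u) * (0 + 0 + r₁u) - (bu + r₀u + r₁u) * (o + a₀ + a₁ + 0 + 0 + r₁u))) := by ring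
    rw [e]; exact sub_nonneg.2 hFJ'
  have hFM : 0 ≤ ((bu + r₀u + r₁u) * (((o + a₀ + a₁) * (o + a₀ + a₁ + bu + r₀u + r₁u) * (a₁u + r₁u) + ((o + a₀ + a₁) - (bu + r₀u + r₁u)) * (a₁ + r₁u) * (a₀ + a₁ - a₀u - a₁u)) - (o + a₀ + a₁ + bu + r₀u + r₁u) * (a₁ + r₁u) * (a₀u + a₁u) - (o + a₀ + a₁ + bu + r₀u + r₁u) * a₁ * (a₀ + a₁ - a₀u - a₁u))) + ((o + a₀ + a₁ + bu + r₀u + r₁u) * (o + a₀ + a₁ + bu + r₀u + r₁u) * (o + a₀ + a₁) - ((o + a₀ + a₁) * (o + a₀ + a₁ + bu + r₀u + r₁u) * (a₁u + r₁u) + ((o + a₀ + a₁) - (bu + r₀u + r₁u)) * (a₁ + r₁u) * (a₀ + a₁ - a₀u - a₁u)) - (bu + r₀u + r₁u) * (o + a₀ + a₁ + bu + r₀u + r₁u) * (a₀ + a₁ - a₀u - a₁u)) * r₁u - ((o + a₀ + a₁) * (o + a₀ + a₁ + bu + r₀u + r₁u) * (a₁u + r₁u) + ((o + a₀ + a₁)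 - (bu + r₀u + r₁u)) * (a₁ + r₁u) * (a₀ + a₁ - a₀u - a₁u)) * (bu + r₀u) := by
    have e : ((bu + r₀u + r₁u) * (((o + a₀ + a₁) * (o + a₀ + a₁ + bu + r₀u + r₁u) * (a₁u + r₁u) + ((o + a₀ + a₁) - (bu + r₀u + r₁u)) * (a₁ + r₁u) * (a₀ + a₁ - a₀u - a₁u)) - (o + a₀ + a₁ + bu + r₀u + r₁u) * (a₁ + r₁u) * (a₀u + a₁u) - (o + a₀ + a₁ + bu + r₀u + r₁u) * a₁ * (a₀ + a₁ - a₀u - a₁u))) + ((o + a₀ + a₁ + bu + r₀u + r₁u) * (o + a₀ + a₁ + bu + r₀u + r₁u) * (o + a₀ + a₁) - ((o + a₀ + a₁) * (o + a₀ + a₁ + bu + r₀u + r₁u) * (a₁u + r₁u) + ((o + a₀ + a₁) - (bu + r₀u + r₁u)) * (a₁ + r₁u) * (a₀ + a₁ - a₀u - a₁u)) - (bu + r₀u + r₁u) * (o + a₀ + a₁ + bu + r₀u + r₁u) * (a₀ + a₁ - a₀u - a₁u)) * r₁u - ((o + a₀ + a₁) * (o + a₀ + a₁ + bu + r₀u +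 r₁u) * (a₁u + r₁u) + ((o + a₀ + a₁) - (bu + r₀u + r₁u)) * (a₁ + r₁u) * (a₀ + a₁ - a₀u - a₁u)) * (bu + r₀u)
        = (o + a₀ + a₁ + bu + r₀u + r₁u) * ((bu + r₀u + r₁u) * (a₁ + r₁u) * o + (o + a₀ + a₁) * ((o + a₀) * r₁u - a₁ * (bu + r₀u))) := by ring
    rw [e]
    apply mul_nonneg (by positivity)
    exact add_nonneg (by positivity) (mul_nonneg (by positivity) (sub_nonneg.2 h1))
  have hstar : (bu + r₀u + r₁u) * (o + a₀ + a₁ + bu + r₀u + r₁u) * (a₁ + r₁u) * a₀u * ((ou + a₀u) * r₁u - a₁u * (bu + r₀u)) ≤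
      (ou + a₀u) * r₁u * (((bu + r₀u + r₁u) * (((o + a₀ + a₁) * (o + a₀ + a₁ + bu + r₀u + r₁u) * (a₁u + r₁u) + ((o + a₀ + a₁) - (bu + r₀u + r₁u)) * (a₁ + r₁u) * (a₀ + a₁ - a₀u - a₁u)) - (o + a₀ + a₁ + bu + r₀u + r₁u) * (a₁ + r₁u) * (a₀u + a₁u) - (o + a₀ + a₁ + bu + r₀u + r₁u) * a₁ * (a₀ + a₁ - a₀u - a₁u))) + ((o + a₀ + a₁ + bu + r₀u + r₁u) * (o + a₀ + a₁ + bu + r₀u + r₁u) * (o + a₀ + a₁) - ((o + a₀ + a₁) * (o + a₀ + a₁ + bu + r₀u + r₁u) * (a₁u + r₁u) + ((o + a₀ + a₁) - (bu + r₀u + r₁u)) * (a₁ + r₁u) * (a₀ + a₁ - a₀u - a₁u)) - (bu + r₀u + r₁u) * (o + a₀ + a₁ + bu + r₀u + r₁u) * (a₀ + a₁ - a₀u - a₁u)) * r₁u + (bu + r₀u + r₁u) * (o + a₀ + a₁ + bu + r₀u + r₁u) * (a₁ + r₁u) * a₀u - (bu + r₀u + r₁u) * (o + a₀ + a₁ +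 bu + r₀u + r₁u) * ((o + a₀ + a₁ + bu + r₀u + r₁u) - (a₁ + r₁u)) * a₁u - ((o + a₀ + a₁) * (o + a₀ + a₁ + bu + r₀u + r₁u) * (a₁u + r₁u) + ((o + a₀ + a₁) - (bu + r₀u + r₁u)) * (a₁ + r₁u) * (a₀ + a₁ - a₀u - a₁u)) * (bu + r₀u)) := by
    have e1 : (bu + r₀u + r₁u) * (o + a₀ + a₁ + bu + r₀u + r₁u) * (a₁ + r₁u) * a₀u * ((ou + a₀u) * r₁u - a₁u * (bu + r₀u)) = (o + a₀ + a₁ + bu + r₀u + r₁u) * ((bu + r₀u + r₁u) * (a₁ + r₁u) * a₀u * ((ou + a₀u) * r₁u - a₁u * (bu + r₀u))) := by ring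
    have e2 : (ou + a₀u) * r₁u * (((bu + r₀u + r₁u) * (((o + a₀ + a₁) * (o + a₀ + a₁ + bu + r₀u + r₁u) * (a₁u + r₁u) + ((o + a₀ + a₁) - (bu + r₀u + r₁u)) * (a₁ + r₁u) * (a₀ + a₁ - a₀u - a₁u)) - (o + a₀ + a₁ + bu + r₀u + r₁u) * (a₁ + r₁u) * (a₀u + a₁u) - (o + a₀ + a₁ + bu + r₀u + r₁u) * a₁ * (a₀ + a₁ - a₀u - a₁u))) + ((o + a₀ + a₁ + bu + r₀u + r₁u) * (o + a₀ + a₁ + bu + r₀u + r₁u) * (o + a₀ + a₁) - ((o + a₀ + a₁) * (o + a₀ + a₁ + bu + r₀u + r₁u) * (a₁u + r₁u) + ((o + a₀ + a₁) - (bu + r₀u + r₁u)) * (a₁ + r₁u) * (a₀ + a₁ - a₀u - a₁u)) - (bu + r₀u + r₁u) * (o + a₀ + a₁ + bu + r₀u + r₁u) * (a₀ + a₁ - a₀u - a₁u)) * r₁u + (bu + r₀u + r₁u) * (o + a₀ + a₁ + bu + r₀u + r₁u) * (a₁ + r₁u) * a₀u - (bu + r₀u + r₁u) * (o + a₀ +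 a₁ + bu + r₀u + r₁u) * ((o + a₀ + a₁ + bu + r₀u + r₁u) - (a₁ + r₁u)) * a₁u - ((o + a₀ + a₁) * (o + a₀ + a₁ + bu + r₀u + r₁u) * (a₁u + r₁u) + ((o + a₀ + a₁) - (bu + r₀u + r₁u)) * (a₁ + r₁u) * (a₀ + a₁ - a₀u - a₁u)) * (bu + r₀u)) = (o + a₀ + a₁ + bu + r₀u + r₁u) * ((ou + a₀u) * r₁u * ((o + a₀ + a₁ + bu + r₀u + r₁u) * (o + a₀ + a₁) * r₁u - (o + a₀ + a₁ + bu + r₀u + r₁u) * (bu + r₀u + r₁u) * a₁u - (bu + r₀u + r₁u) * (a₁ + r₁u) * (a₀ + a₁ - a₀u - a₁u))) := by ring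
    rw [e1, e2]
    exact mul_le_mul_of_nonneg_left hS' (by positivity)
  have key := xa_general_gate_alg ((bu + r₀u + r₁u) * (((o + a₀ + a₁) * (o + a₀ + a₁ + bu + r₀u + r₁u) * (a₁u + r₁u) + ((o + a₀ + a₁) - (bu + r₀u + r₁u)) * (a₁ + r₁u) * (a₀ + a₁ - a₀u - a₁u)) - (o + a₀ + a₁ + bu + r₀u + r₁u) * (a₁ + r₁u) * (a₀u + a₁u) - (o + a₀ + a₁ + bu + r₀u + r₁u) * a₁ * (a₀ + a₁ - a₀u - a₁u))) ((bu + r₀u + r₁u) * (o + a₀ + a₁ + bu + r₀u + r₁u) * ((o + a₀ + a₁ + bu + r₀u + r₁u) - (a₁ + r₁u))) ((o + a₀ + a₁) * (o + a₀ + a₁ + bu + r₀u + r₁u) * (a₁u + r₁u) + ((o + a₀ + a₁) - (bu + r₀u + r₁u)) * (a₁ + r₁u) * (a₀ + a₁ - a₀u - a₁u)) ((o + a₀ + a₁ + bu + r₀u + r₁u) * (o + a₀ + a₁ + bu + r₀u + r₁u) * (o + a₀ + a₁) - ((o + a₀ + a₁) * (o + a₀ + a₁ + bu + r₀u + r₁u)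 * (a₁u + r₁u) + ((o + a₀ + a₁) - (bu + r₀u + r₁u)) * (a₁ + r₁u) * (a₀ + a₁ - a₀u - a₁u)) - (bu + r₀u + r₁u) * (o + a₀ + a₁ + bu + r₀u + r₁u) * (a₀ + a₁ - a₀u - a₁u)) ((bu + r₀u + r₁u) * (o + a₀ + a₁ + bu + r₀u + r₁u) * (a₁ + r₁u)) ou a₀u a₁u (bu + r₀u) r₁u ow a₀w a₁w (bw + r₀w) r₁w
    (mul_nonneg (mul_nonneg (by positivity) (by positivity)) (by linarith)) (by positivity)
    hou ha₀u ha₁u (add_nonneg hbu hr₀u) hr₁u ha₀w ha₁w (add_nonneg hbw hr₀w) hr₁w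
    hw_Dp1 (add_le_add hw_Dpp hw_Dst0) hw_Dst1 (by linarith [H2]) (by linarith [H3]) (by linarith [H4]) H5 s3 hF0 hFT hFJ hFM hstar
  have e : (o + a₀ + a₁ + bu + r₀u + r₁u) * ((o + a₀ + a₁ + bu + r₀u + r₁u) * (o + a₀ + a₁ + bu + r₀u + r₁u) * r₁w - (o + a₀ + a₁ + bu + r₀u + r₁u) * (a₁ + r₁u) * (bw + r₀w + r₁w) - (o + a₀ + a₁ + bu + r₀u + r₁u) * (bu + r₀u + r₁u) * (a₁w + r₁w) + (bu + r₀u + r₁u) * (a₁ + r₁u) * (o + a₀w + a₁w + bw + r₀w + r₁w)) - (((o + a₀ + a₁ + bu + r₀u + r₁u) * (bu + r₀u + r₁u) - (bu + r₀u + r₁u) * (o + a₀u + a₁u + bu + r₀u + r₁u)) * ((o + a₀ + a₁ + bu + r₀u + r₁u) * (a₁ + r₁w) - (a₁ + r₁u) * (o + a₀ + a₁ + bw + r₀w + r₁w)) + ((o + a₀ + a₁ + bu + r₀u + r₁u) * (a₁u + r₁u) - (a₁ + r₁u) * (o + a₀u + a₁u + bu + r₀u + r₁u)) * ((o + a₀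 + a₁ + bu + r₀u + r₁u) * (bw + r₀w + r₁w) - (bu + r₀u + r₁u) * (o + a₀ + a₁ + bw + r₀w + r₁w))) = ((bu + r₀u + r₁u) * (((o + a₀ + a₁) * (o + a₀ + a₁ + bu + r₀u + r₁u) * (a₁u + r₁u) + ((o + a₀ + a₁) - (bu + r₀u + r₁u)) * (a₁ + r₁u) * (a₀ + a₁ - a₀u - a₁u)) - (o + a₀ + a₁ + bu + r₀u + r₁u) * (a₁ + r₁u) * (a₀u + a₁u) - (o + a₀ + a₁ + bu + r₀u + r₁u) * a₁ * (a₀ + a₁ - a₀u - a₁u))) + (bu + r₀u + r₁u) * (o + a₀ + a₁ + bu + r₀u + r₁u) * (a₁ + r₁u) * a₀w - (bu + r₀u + r₁u) * (o + a₀ + a₁ + bu + r₀u + r₁u) * ((o + a₀ + a₁ + bu + r₀u + r₁u) - (a₁ + r₁u)) * a₁w - ((o + a₀ + a₁) * (o + a₀ + a₁ + bu + r₀u + r₁u) * (a₁u + r₁u) + ((o + a₀ + a₁) - (bu + r₀u + r₁u)) * (a₁ + r₁u) * (a₀ + a₁ - a₀u - a₁u)) * (bw + r₀w) + ((o + a₀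 + a₁ + bu + r₀u + r₁u) * (o + a₀ + a₁ + bu + r₀u + r₁u) * (o + a₀ + a₁) - ((o + a₀ + a₁) * (o + a₀ + a₁ + bu + r₀u + r₁u) * (a₁u + r₁u) + ((o + a₀ + a₁) - (bu + r₀u + r₁u)) * (a₁ + r₁u) * (a₀ + a₁ - a₀u - a₁u)) - (bu + r₀u + r₁u) * (o + a₀ + a₁ + bu + r₀u + r₁u) * (a₀ + a₁ - a₀u - a₁u)) * r₁w := by ring
  linarith

end GeneralGateCells

end Summit.Ventures.PercRepro2.Coin
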